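import Summits.QuantumFields.BalabanUV.Beta.GAN24.ExponentialChartBaseMixedJets
import Summits.QuantumFields.BalabanUV.Beta.GAN24.ExponentialChartMixedBackgrounds

/-!
# `BalabanUV.Beta.GAN24.ExponentialChartBaseBackgrounds` — binder row G-an2-4 ∕ (CONV-C), route R7 «TWO CURRENCIES», PART 267: THE LETTERS OF THE HESSIAN AT A BASE POINT ARE
# BACKGROUNDS.  The jets of PART 266 (the chart `exp(iη(A₀ + sA + rB))` at `U₀ = e^{iηA₀}`) carry the base phase `e^{±θ₀}` and a NONZERO zeroth-order part; here their Lipschitz ∕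
# bounded-background constants are derived WITHOUT any transcendental estimate, displaying only `(α, β)` of the real directions `A, B` and `(α₀, β₀)` of the BASE CONNECTION
# `V₀ = −w₀ = connV U₀ = n(1 − e^{θ₀})` (the hypothesis NE2 ∕ PART 250 already display for the base letter): `e^{θ₀} = 1 − V₀∕n`, `e^{−θ₀} = 1 − V̄₀∕n`,
# `−n(e^{θ₀} − e^{−θ₀}) = V₀ − V̄₀`.  §1 GENERIC closure rules (products, conjugates, constants, division by the level, sums over directions of products); §2 the base phase;
# §3 the three letter pairs of PART 266: `−iA·e^{θ₀}`, `−(iA)(iB∕n)e^{θ₀}` (Lipschitz) and `−nΣ_ν(iA_ν)(e^{θ₀,ν} − e^{−θ₀,ν}) = Σ_ν(iA_ν)(V₀,ν − V̄₀,ν)`,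
# `−Σ_ν(iA_ν)(iB_ν)(e^{θ₀,ν} + e^{−θ₀,ν})` (bounded) (unit b2b-balaban-gan24-p3, gen 67; v1)

NOT IN PRINT; OUR PROOF ([folklore] bookkeeping BY NAME over PART 253 (`lipschitzBackground_add ∕ _const_mul ∕ _mono ∕ _negI_mul`), PART 246 (`cast_lev_le_succ`), PART 245
(`conj_theta`), NE2's `connV`; nothing printed is a hypothesis).
HONEST FRAMING (cell contract, verbatim): «discharging `BetaPertH` makes Bałaban's UV stability UNCONDITIONAL — a real constructive-QFT result; it is NOT the
continuum limit and NOT the Clay problem.»  HONEST DEPENDENCY (verbatim): «continuum YM on T⁴ ⇐ BetaPertH ∧ nine spine estimates (0/9 proved); BetaPertH ⇐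
(D1) ∧ (D4) ∧ CAP+tail; G-an2-4 gates asym, D1 and NE2/3/4.»

WHAT THIS FILE PROVES (0 sorry, 0 `def`):
* §1 (GENERIC) **`lipschitzBackground_mul`** (`(α_Uα_V, α_Uβ_V + β_Uα_V)`), `lipschitzBackground_star`, `lipschitzBackground_const`, `lipschitzBackground_sub`,
  **`lipschitzBackground_div_lev`** (`(α, α + β)`), **`boundedBackground_sum_mul`** (`(dα_Uα_V, d(α_Uβ_V + β_Uα_V))`).
* §2 `connV_base`, `star_connV_base`, `basePhase_eq`, `baseConjPhase_eq`, **`lipschitzBackground_basePhase`** (`e^{θ₀}`: `(1 + α₀, α₀ + β₀)`), `lipschitzBackground_baseConjPhase`.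
* §3 **`lipschitzBackground_baseJetV`**, **`lipschitzBackground_baseMixedJetV`**, **`boundedBackground_baseJetZ`**, **`boundedBackground_baseMixedJetZ`** (PART 266's letters).
WHAT IT DOES NOT DO: the END (next PART).  SUPPLIER work; NEVER «G-an2-4 closed»; NOT (CONV-C), NOT D1, NOT `BetaPertH`, NOT continuum, NOT Clay.
Records: `HOME/b2b-balaban-gan24-p3/gen67/README.md`.
-/

noncomputable section

open scoped BigOperators ComplexConjugate Matrix Matrix.Norms.L2Operator
open Filter Topology

namespace Summit.QuantumFields.BalabanUV.Beta.GAN24.ExponentialChartBaseBackgrounds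

open Literature.MathematicalPhysics.QuantumFieldTheory.Balaban1983to89
open Literature.MathematicalPhysics.QuantumFieldTheory.Balaban1983to89.B5Prop11Plancherel (Tor fine)
open Literature.MathematicalPhysics.QuantumFieldTheory.Balaban1983to89.B5G183RateUnitTower (lev)
open Summit.QuantumFields.BalabanUV.T4Continuum
open Summit.QuantumFields.BalabanUV.T4Continuum.BalabanAveragedTowerUnit (idx one_le_lev')
open Summit.QuantumFields.BalabanUV.T4Continuum.BlockPairingGeometry (tau parT)
open Summit.QuantumFields.BalabanUV.T4Continuum.FirstOrderBackgroundModel (LipschitzBackground)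
open Summit.QuantumFields.BalabanUV.T4Continuum.PerturbationAlgebra (BoundedBackground)
open Summit.QuantumFields.BalabanUV.T4Continuum.AbelianCovariantLaplacian (connV conn negConn)
open Summit.QuantumFields.BalabanUV.Beta.GAN24.ExponentialChartJets (conj_theta)
open Summit.QuantumFields.BalabanUV.Beta.GAN24.ExponentialChartBackgrounds (cast_lev_le_succ)
open Summit.QuantumFields.BalabanUV.Beta.GAN24.ExponentialChartMixedBackgrounds (lipschitzBackground_add lipschitzBackground_const_mul lipschitzBackground_mono
  lipschitzBackground_negI_mul boundedBackground_mono)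

variable {d : ℕ} (L : ℕ) [NeZero L] (M : Fin d → ℕ) [hM : ∀ μ, NeZero (M μ)]

/-! ## §1 GENERIC closure rules -/

section Closure

omit [NeZero L] hM in
/-- **`lipschitzBackground_mul`** — products: `(α_Uα_V, α_Uβ_V + β_Uα_V)` (`UV(τ) − UV = U(τ)(V(τ) − V) + (U(τ) − U)V`). [folklore] -/
theorem lipschitzBackground_mul {U V : (k : ℕ) → Fin d → (idx L M k → ℂ)} {αU βU αV βV : ℝ} (hU : LipschitzBackground L M U αU βU) (hV : LipschitzBackground L M V αV βV) :
    LipschitzBackground L M (fun k ν x => U k ν x * V k ν x) (αU * αV) (αU * βV + βU * αV) where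
  nonneg := ⟨mul_nonneg hU.nonneg.1 hV.nonneg.1, add_nonneg (mul_nonneg hU.nonneg.1 hV.nonneg.2) (mul_nonneg hU.nonneg.2 hV.nonneg.1)⟩
  bound := fun k μ i => by
    rw [norm_mul]
    exact mul_le_mul (hU.bound k μ i) (hV.bound k μ i) (norm_nonneg _) hU.nonneg.1
  lipschitz := fun k μ ν i => by
    have e : U k μ (tau (fine (lev L k) M) ν i) * V k μ (tau (fine (lev L k) M) ν i) - U k μ i * V k μ i
        = U k μ (tau (fine (lev L k) M) ν i) * (V k μ (tau (fine (lev L k) M) ν i) - V k μ i) + (U k μ (tau (fine (lev L k) M) ν i) - U k μ i) * V k μ i := by ring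
    rw [e, add_div]
    refine (norm_add_le _ _).trans (add_le_add ?_ ?_)
    · rw [norm_mul, mul_div_assoc]
      exact mul_le_mul (hU.bound k μ _) (hV.lipschitz k μ ν i) (norm_nonneg _) hU.nonneg.1
    · rw [norm_mul, show βU * αV / ((lev L k : ℕ) : ℝ) = βU / ((lev L k : ℕ) : ℝ) * αV by ring]
      exact mul_le_mul (hU.lipschitz k μ ν i) (hV.bound k μ i) (norm_nonneg _) (div_nonneg hU.nonneg.2 (Nat.cast_nonneg _))
  consistent := fun k μ i => by
    have e : U (k + 1) μ i * V (k + 1) μ i - U k μ (parT (lev L k) L M i) * V k μ (parT (lev L k) L M i)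
        = U (k + 1) μ i * (V (k + 1) μ i - V k μ (parT (lev L k) L M i)) + (U (k + 1) μ i - U k μ (parT (lev L k) L M i)) * V k μ (parT (lev L k) L M i) := by ring
    rw [e, add_div]
    refine (norm_add_le _ _).trans (add_le_add ?_ ?_)
    · rw [norm_mul, mul_div_assoc]
      exact mul_le_mul (hU.bound (k + 1) μ i) (hV.consistent k μ i) (norm_nonneg _) hU.nonneg.1
    · rw [norm_mul, show βU * αV / ((lev L k : ℕ) : ℝ) = βU / ((lev L k : ℕ) : ℝ) * αV by ring]
      exact mul_le_mul (hU.consistent k μ i) (hV.bound k μ _) (norm_nonneg _) (div_nonneg hU.nonneg.2 (Nat.cast_nonneg _))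

omit [NeZero L] hM in
/-- conjugates: same constants. [folklore] -/
theorem lipschitzBackground_star {V : (k : ℕ) → Fin d → (idx L M k → ℂ)} {α β : ℝ} (hV : LipschitzBackground L M V α β) :
    LipschitzBackground L M (fun k ν x => star (V k ν x)) α β where
  nonneg := hV.nonneg
  bound := fun k μ i => by rw [norm_star]; exact hV.bound k μ i
  lipschitz := fun k μ ν i => by rw [← star_sub, norm_star]; exact hV.lipschitz k μ ν i
  consistent := fun k μ i => by rw [← star_sub, norm_star]; exact hV.consistent k μ i

omit [NeZero L] hM in
/-- constants: `(‖c‖, 0)`. [folklore] -/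
theorem lipschitzBackground_const (c : ℂ) : LipschitzBackground L M (fun _ _ _ => c) ‖c‖ 0 where
  nonneg := ⟨norm_nonneg c, le_rfl⟩
  bound := fun _ _ _ => le_rfl
  lipschitz := fun _ _ _ _ => by rw [sub_self, norm_zero, zero_div]
  consistent := fun _ _ _ => by rw [sub_self, norm_zero, zero_div]

omit [NeZero L] hM in
/-- differences: `(α + α′, β + β′)`. [folklore] -/
theorem lipschitzBackground_sub {V V' : (k : ℕ) → Fin d → (idx L M k → ℂ)} {α β α' β' : ℝ} (h : LipschitzBackground L M V α β) (h' : LipschitzBackground L M V' α' β') :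
    LipschitzBackground L M (fun k ν x => V k ν x - V' k ν x) (α + α') (β + β') := by
  have h1 := lipschitzBackground_add L M h (lipschitzBackground_const_mul L M h' (-1))
  rw [norm_neg, norm_one, one_mul, one_mul] at h1
  have e : (fun k ν (x : idx L M k) => V k ν x + -1 * V' k ν x) = fun k ν x => V k ν x - V' k ν x := by
    funext k ν x
    ring
  rw [e] at h1
  exact h1

omit hM in
/-- **`lipschitzBackground_div_lev`** — division by the level `n_k`: `(α, α + β)` (`n_k ≥ 1`, `n_{k+1} ≥ n_k`; the consistency defect of `1∕n` is `≤ 1∕n_k`). [folklore] -/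
theorem lipschitzBackground_div_lev {V : (k : ℕ) → Fin d → (idx L M k → ℂ)} {α β : ℝ} (hV : LipschitzBackground L M V α β) :
    LipschitzBackground L M (fun k ν x => V k ν x / ((lev L k : ℕ) : ℂ)) α (α + β) := by
  obtain ⟨hα, hβ⟩ := hV.nonneg
  have hn1 : ∀ k, (1 : ℝ) ≤ ((lev L k : ℕ) : ℝ) := fun k => Nat.one_le_cast.mpr (one_le_lev' L k)
  have hn0 : ∀ k, (0 : ℝ) < ((lev L k : ℕ) : ℝ) := fun k => lt_of_lt_of_le zero_lt_one (hn1 k)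
  refine ⟨⟨hα, add_nonneg hα hβ⟩, fun k μ i => ?_, fun k μ ν i => ?_, fun k μ i => ?_⟩
  · rw [norm_div, Complex.norm_natCast]
    exact (div_le_self (norm_nonneg _) (hn1 k)).trans (hV.bound k μ i)
  · rw [← sub_div, norm_div, Complex.norm_natCast]
    calc ‖V k μ (tau (fine (lev L k) M) ν i) - V k μ i‖ / ((lev L k : ℕ) : ℝ) ≤ ‖V k μ (tau (fine (lev L k) M) ν i) - V k μ i‖ := div_le_self (norm_nonneg _) (hn1 k)
      _ ≤ β / ((lev L k : ℕ) : ℝ) := hV.lipschitz k μ ν i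
      _ ≤ (α + β) / ((lev L k : ℕ) : ℝ) := div_le_div_of_nonneg_right (by linarith) (hn0 k).le
  · have e : V (k + 1) μ i / ((lev L (k + 1) : ℕ) : ℂ) - V k μ (parT (lev L k) L M i) / ((lev L k : ℕ) : ℂ)
        = (V (k + 1) μ i - V k μ (parT (lev L k) L M i)) / ((lev L (k + 1) : ℕ) : ℂ)
          + V k μ (parT (lev L k) L M i) * (1 / ((lev L (k + 1) : ℕ) : ℂ) - 1 / ((lev L k : ℕ) : ℂ)) := by ring
    rw [e]
    have hle := cast_lev_le_succ L k
    have h1 : ‖(V (k + 1) μ i - V k μ (parT (lev L k) L M i)) / ((lev L (k + 1) : ℕ) : ℂ)‖ ≤ β / ((lev L k : ℕ) : ℝ) := by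
      rw [norm_div, Complex.norm_natCast]
      exact (div_le_self (norm_nonneg _) (hn1 (k + 1))).trans (hV.consistent k μ i)
    have h2 : ‖V k μ (parT (lev L k) L M i) * (1 / ((lev L (k + 1) : ℕ) : ℂ) - 1 / ((lev L k : ℕ) : ℂ))‖ ≤ α / ((lev L k : ℕ) : ℝ) := by
      rw [norm_mul]
      have hq : ‖(1 / ((lev L (k + 1) : ℕ) : ℂ) - 1 / ((lev L k : ℕ) : ℂ))‖ ≤ 1 / ((lev L k : ℕ) : ℝ) := by
        have e1 : (1 / ((lev L (k + 1) : ℕ) : ℂ) - 1 / ((lev L k : ℕ) : ℂ)) = (((1 / ((lev L (k + 1) : ℕ) : ℝ) - 1 / ((lev L k : ℕ) : ℝ) : ℝ)) : ℂ) := by push_cast; ring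
        rw [e1, Complex.norm_real, Real.norm_eq_abs, abs_sub_comm, abs_of_nonneg (by
          rw [sub_nonneg]; exact one_div_le_one_div_of_le (hn0 k) hle)]
        have : 0 ≤ 1 / ((lev L (k + 1) : ℕ) : ℝ) := by positivity
        linarith
      calc ‖V k μ (parT (lev L k) L M i)‖ * ‖(1 / ((lev L (k + 1) : ℕ) : ℂ) - 1 / ((lev L k : ℕ) : ℂ))‖ ≤ α * (1 / ((lev L k : ℕ) : ℝ)) :=
            mul_le_mul (hV.bound k μ _) hq (norm_nonneg _) hα
        _ = α / ((lev L k : ℕ) : ℝ) := by ring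
    calc _ ≤ β / ((lev L k : ℕ) : ℝ) + α / ((lev L k : ℕ) : ℝ) := (norm_add_le _ _).trans (add_le_add h1 h2)
      _ = (α + β) / ((lev L k : ℕ) : ℝ) := by ring

omit [NeZero L] hM in
/-- **`boundedBackground_sum_mul`** — the direction sum of a product of two Lipschitz backgrounds is a bounded background: `(dα_Uα_V, d(α_Uβ_V + β_Uα_V))`. [folklore] -/
theorem boundedBackground_sum_mul {U V : (k : ℕ) → Fin d → (idx L M k → ℂ)} {αU βU αV βV : ℝ} (hU : LipschitzBackground L M U αU βU)
    (hV : LipschitzBackground L M V αV βV) :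
    BoundedBackground L M (fun k x => ∑ ν, U k ν x * V k ν x) (d * (αU * αV)) (d * (αU * βV + βU * αV)) := by
  have hP := lipschitzBackground_mul L M hU hV
  refine ⟨⟨by have := hP.nonneg.1; positivity, by have := hP.nonneg.2; positivity⟩, fun k i => ?_, fun k i => ?_⟩
  · calc ‖∑ ν, U k ν i * V k ν i‖ ≤ ∑ ν : Fin d, αU * αV := (norm_sum_le _ _).trans (Finset.sum_le_sum fun ν _ => hP.bound k ν i)
      _ = d * (αU * αV) := by rw [Finset.sum_const, Finset.card_univ, Fintype.card_fin, nsmul_eq_mul]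
  · rw [← Finset.sum_sub_distrib]
    calc ‖∑ ν, (U (k + 1) ν i * V (k + 1) ν i - U k ν (parT (lev L k) L M i) * V k ν (parT (lev L k) L M i))‖
        ≤ ∑ ν : Fin d, (αU * βV + βU * αV) / ((lev L k : ℕ) : ℝ) := (norm_sum_le _ _).trans (Finset.sum_le_sum fun ν _ => hP.consistent k ν i)
      _ = d * (αU * βV + βU * αV) / ((lev L k : ℕ) : ℝ) := by rw [Finset.sum_const, Finset.card_univ, Fintype.card_fin, nsmul_eq_mul, mul_div_assoc]

end Closure

/-! ## §2 The base phase through the base connection `V₀ = n(1 − e^{θ₀})` -/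

section Phase

omit [NeZero L] hM in
/-- the base connection: `−w₀ = n − n·e^{θ₀}`. [folklore] -/
theorem connV_base (A₀ : (k : ℕ) → Fin d → (idx L M k → ℝ)) :
    connV L M (fun k ν x => Complex.exp (Complex.I * (A₀ k ν x : ℂ) / ((lev L k : ℕ) : ℂ)))
      = fun k ν x => ((lev L k : ℕ) : ℂ) - ((lev L k : ℕ) : ℂ) * Complex.exp (Complex.I * (A₀ k ν x : ℂ) / ((lev L k : ℕ) : ℂ)) := by
  funext k ν x
  simp only [connV, negConn, conn]
  ring

omit [NeZero L] hM in
/-- its conjugate: `(−w₀)* = n − n·e^{−θ₀}` (real `A₀`). [folklore] -/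
theorem star_connV_base (A₀ : (k : ℕ) → Fin d → (idx L M k → ℝ)) (k : ℕ) (ν : Fin d) (x : idx L M k) :
    star (connV L M (fun k ν x => Complex.exp (Complex.I * (A₀ k ν x : ℂ) / ((lev L k : ℕ) : ℂ))) k ν x)
      = ((lev L k : ℕ) : ℂ) - ((lev L k : ℕ) : ℂ) * Complex.exp (-(Complex.I * (A₀ k ν x : ℂ) / ((lev L k : ℕ) : ℂ))) := by
  rw [connV_base]
  dsimp only
  rw [Complex.star_def, map_sub, map_mul, map_natCast, ← Complex.exp_conj, conj_theta]

omit hM in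
/-- `e^{θ₀} = 1 + (−1)·(V₀∕n)`. [folklore] -/
theorem basePhase_eq (A₀ : (k : ℕ) → Fin d → (idx L M k → ℝ)) :
    (fun k ν (x : idx L M k) => Complex.exp (Complex.I * (A₀ k ν x : ℂ) / ((lev L k : ℕ) : ℂ)))
      = fun k ν x => (1 : ℂ) + (-1 : ℂ) * (connV L M (fun k ν x => Complex.exp (Complex.I * (A₀ k ν x : ℂ) / ((lev L k : ℕ) : ℂ))) k ν x / ((lev L k : ℕ) : ℂ)) := by
  funext k ν x
  rw [connV_base]
  have hn : ((lev L k : ℕ) : ℂ) ≠ 0 := by exact_mod_cast NeZero.ne (lev L k)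
  field_simp
  ring

omit hM in
/-- `e^{−θ₀} = 1 + (−1)·(V̄₀∕n)`. [folklore] -/
theorem baseConjPhase_eq (A₀ : (k : ℕ) → Fin d → (idx L M k → ℝ)) :
    (fun k ν (x : idx L M k) => Complex.exp (-(Complex.I * (A₀ k ν x : ℂ) / ((lev L k : ℕ) : ℂ))))
      = fun k ν x => (1 : ℂ) + (-1 : ℂ) * (star (connV L M (fun k ν x => Complex.exp (Complex.I * (A₀ k ν x : ℂ) / ((lev L k : ℕ) : ℂ))) k ν x) / ((lev L k : ℕ) : ℂ)) := by
  funext k ν x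
  rw [star_connV_base]
  have hn : ((lev L k : ℕ) : ℂ) ≠ 0 := by exact_mod_cast NeZero.ne (lev L k)
  field_simp
  ring

omit hM in
/-- **`lipschitzBackground_basePhase`** — the base phase `e^{θ₀}` is a Lipschitz background `(1 + α₀, α₀ + β₀)` whenever the base connection `V₀ = n(1 − e^{θ₀})` is Lipschitz
`(α₀, β₀)` (no transcendental estimate: `e^{θ₀} = 1 − V₀∕n`). [folklore] -/
theorem lipschitzBackground_basePhase {A₀ : (k : ℕ) → Fin d → (idx L M k → ℝ)} {α₀ β₀ : ℝ}
    (hV₀ : LipschitzBackground L M (connV L M (fun k ν x => Complex.exp (Complex.I * (A₀ k ν x : ℂ) / ((lev L k : ℕ) : ℂ)))) α₀ β₀) :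
    LipschitzBackground L M (fun k ν (x : idx L M k) => Complex.exp (Complex.I * (A₀ k ν x : ℂ) / ((lev L k : ℕ) : ℂ))) (1 + α₀) (α₀ + β₀) := by
  have h := lipschitzBackground_add L M (lipschitzBackground_const L M (1 : ℂ)) (lipschitzBackground_const_mul L M (lipschitzBackground_div_lev L M hV₀) (-1))
  rw [norm_one, norm_neg, norm_one, one_mul, one_mul, zero_add] at h
  rw [basePhase_eq]
  exact h

omit hM in
/-- `lipschitzBackground_baseConjPhase` — the conjugate base phase `e^{−θ₀}`: `(1 + α₀, α₀ + β₀)`. [folklore] -/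
theorem lipschitzBackground_baseConjPhase {A₀ : (k : ℕ) → Fin d → (idx L M k → ℝ)} {α₀ β₀ : ℝ}
    (hV₀ : LipschitzBackground L M (connV L M (fun k ν x => Complex.exp (Complex.I * (A₀ k ν x : ℂ) / ((lev L k : ℕ) : ℂ)))) α₀ β₀) :
    LipschitzBackground L M (fun k ν (x : idx L M k) => Complex.exp (-(Complex.I * (A₀ k ν x : ℂ) / ((lev L k : ℕ) : ℂ)))) (1 + α₀) (α₀ + β₀) := by
  have h := lipschitzBackground_add L M (lipschitzBackground_const L M (1 : ℂ))
    (lipschitzBackground_const_mul L M (lipschitzBackground_div_lev L M (lipschitzBackground_star L M hV₀)) (-1))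
  rw [norm_one, norm_neg, norm_one, one_mul, one_mul, zero_add] at h
  rw [baseConjPhase_eq]
  exact h

end Phase

/-! ## §3 PART 266's letters are backgrounds -/

section Letters

omit [NeZero L] hM in
/-- `iB` is Lipschitz `(α, β)` when the real background `B` is. [folklore] -/
theorem lipschitzBackground_I_mul {B : (k : ℕ) → Fin d → (idx L M k → ℝ)} {α β : ℝ} (hB : LipschitzBackground L M (fun k ν x => (B k ν x : ℂ)) α β) :
    LipschitzBackground L M (fun k ν x => Complex.I * (B k ν x : ℂ)) α β := by
  have h := lipschitzBackground_const_mul L M hB Complex.I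
  rw [Complex.norm_I, one_mul, one_mul] at h
  exact h

omit hM in
/-- **`lipschitzBackground_baseJetV`** — the twisted first jet `−iA·e^{θ₀}`: `(α(1 + α₀), α(α₀ + β₀) + β(1 + α₀))`. [folklore] -/
theorem lipschitzBackground_baseJetV {A₀ A : (k : ℕ) → Fin d → (idx L M k → ℝ)} {α₀ β₀ α β : ℝ}
    (hA : LipschitzBackground L M (fun k ν x => (A k ν x : ℂ)) α β)
    (hV₀ : LipschitzBackground L M (connV L M (fun k ν x => Complex.exp (Complex.I * (A₀ k ν x : ℂ) / ((lev L k : ℕ) : ℂ)))) α₀ β₀) :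
    LipschitzBackground L M (fun k ν (x : idx L M k) => -(Complex.I * (A k ν x : ℂ)) * Complex.exp (Complex.I * (A₀ k ν x : ℂ) / ((lev L k : ℕ) : ℂ)))
      (α * (1 + α₀)) (α * (α₀ + β₀) + β * (1 + α₀)) :=
  lipschitzBackground_mul L M (lipschitzBackground_negI_mul L M hA) (lipschitzBackground_basePhase L M hV₀)

omit hM in
/-- **`lipschitzBackground_baseMixedJetV`** — the twisted mixed jet `−(iA)(iB∕n)e^{θ₀}`:
`(α²(1 + α₀), α²(α₀ + β₀) + (α(α + β) + βα)(1 + α₀))`. [folklore] -/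
theorem lipschitzBackground_baseMixedJetV {A₀ A B : (k : ℕ) → Fin d → (idx L M k → ℝ)} {α₀ β₀ α β : ℝ}
    (hA : LipschitzBackground L M (fun k ν x => (A k ν x : ℂ)) α β) (hB : LipschitzBackground L M (fun k ν x => (B k ν x : ℂ)) α β)
    (hV₀ : LipschitzBackground L M (connV L M (fun k ν x => Complex.exp (Complex.I * (A₀ k ν x : ℂ) / ((lev L k : ℕ) : ℂ)))) α₀ β₀) :
    LipschitzBackground L M (fun k ν (x : idx L M k) => -(Complex.I * (A k ν x : ℂ)) * (Complex.I * (B k ν x : ℂ) / ((lev L k : ℕ) : ℂ))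
        * Complex.exp (Complex.I * (A₀ k ν x : ℂ) / ((lev L k : ℕ) : ℂ)))
      (α * α * (1 + α₀)) (α * α * (α₀ + β₀) + (α * (α + β) + β * α) * (1 + α₀)) :=
  lipschitzBackground_mul L M (lipschitzBackground_mul L M (lipschitzBackground_negI_mul L M hA) (lipschitzBackground_div_lev L M (lipschitzBackground_I_mul L M hB)))
    (lipschitzBackground_basePhase L M hV₀)

omit [NeZero L] hM in
/-- **`boundedBackground_baseJetZ`** — the zeroth-order part of the twisted first letter, `−nΣ_ν(iA_ν)(e^{θ₀,ν} − e^{−θ₀,ν}) = Σ_ν(iA_ν)(V₀,ν − V̄₀,ν)`: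
`(d·α(α₀ + α₀), d·(α(β₀ + β₀) + β(α₀ + α₀)))`. [folklore] -/
theorem boundedBackground_baseJetZ {A₀ A : (k : ℕ) → Fin d → (idx L M k → ℝ)} {α₀ β₀ α β : ℝ}
    (hA : LipschitzBackground L M (fun k ν x => (A k ν x : ℂ)) α β)
    (hV₀ : LipschitzBackground L M (connV L M (fun k ν x => Complex.exp (Complex.I * (A₀ k ν x : ℂ) / ((lev L k : ℕ) : ℂ)))) α₀ β₀) :
    BoundedBackground L M (fun k (x : idx L M k) => -((lev L k : ℕ) : ℂ) * ∑ ν, (Complex.I * (A k ν x : ℂ))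
        * (Complex.exp (Complex.I * (A₀ k ν x : ℂ) / ((lev L k : ℕ) : ℂ)) - Complex.exp (-(Complex.I * (A₀ k ν x : ℂ) / ((lev L k : ℕ) : ℂ)))))
      (d * (α * (α₀ + α₀))) (d * (α * (β₀ + β₀) + β * (α₀ + α₀))) := by
  have h := boundedBackground_sum_mul L M (lipschitzBackground_I_mul L M hA) (lipschitzBackground_sub L M hV₀ (lipschitzBackground_star L M hV₀))
  have e : (fun k (x : idx L M k) => -((lev L k : ℕ) : ℂ) * ∑ ν, (Complex.I * (A k ν x : ℂ))
        * (Complex.exp (Complex.I * (A₀ k ν x : ℂ) / ((lev L k : ℕ) : ℂ)) - Complex.exp (-(Complex.I * (A₀ k ν x : ℂ) / ((lev L k : ℕ) : ℂ)))))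
      = fun k x => ∑ ν, (Complex.I * (A k ν x : ℂ))
        * (connV L M (fun k ν x => Complex.exp (Complex.I * (A₀ k ν x : ℂ) / ((lev L k : ℕ) : ℂ))) k ν x
          - star (connV L M (fun k ν x => Complex.exp (Complex.I * (A₀ k ν x : ℂ) / ((lev L k : ℕ) : ℂ))) k ν x)) := by
    funext k x
    rw [Finset.mul_sum]
    refine Finset.sum_congr rfl fun ν _ => ?_
    rw [star_connV_base, connV_base]
    ring
  rw [e]
  exact h

omit hM in
/-- **`boundedBackground_baseMixedJetZ`** — the mixed zeroth-order jet `−Σ_ν(iA_ν)(iB_ν)(e^{θ₀,ν} + e^{−θ₀,ν})`: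
`(d·(αα)((1 + α₀) + (1 + α₀)), d·(αα((α₀ + β₀) + (α₀ + β₀)) + (αβ + βα)((1 + α₀) + (1 + α₀))))`. [folklore] -/
theorem boundedBackground_baseMixedJetZ {A₀ A B : (k : ℕ) → Fin d → (idx L M k → ℝ)} {α₀ β₀ α β : ℝ}
    (hA : LipschitzBackground L M (fun k ν x => (A k ν x : ℂ)) α β) (hB : LipschitzBackground L M (fun k ν x => (B k ν x : ℂ)) α β)
    (hV₀ : LipschitzBackground L M (connV L M (fun k ν x => Complex.exp (Complex.I * (A₀ k ν x : ℂ) / ((lev L k : ℕ) : ℂ)))) α₀ β₀) :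
    BoundedBackground L M (fun k (x : idx L M k) => -∑ ν, (Complex.I * (A k ν x : ℂ)) * (Complex.I * (B k ν x : ℂ))
        * (Complex.exp (Complex.I * (A₀ k ν x : ℂ) / ((lev L k : ℕ) : ℂ)) + Complex.exp (-(Complex.I * (A₀ k ν x : ℂ) / ((lev L k : ℕ) : ℂ)))))
      (d * (α * α * ((1 + α₀) + (1 + α₀)))) (d * (α * α * ((α₀ + β₀) + (α₀ + β₀)) + (α * β + β * α) * ((1 + α₀) + (1 + α₀)))) := by
  have h := boundedBackground_sum_mul L M (lipschitzBackground_mul L M (lipschitzBackground_negI_mul L M hA) (lipschitzBackground_I_mul L M hB))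
    (lipschitzBackground_add L M (lipschitzBackground_basePhase L M hV₀) (lipschitzBackground_baseConjPhase L M hV₀))
  have e : (fun k (x : idx L M k) => -∑ ν, (Complex.I * (A k ν x : ℂ)) * (Complex.I * (B k ν x : ℂ))
        * (Complex.exp (Complex.I * (A₀ k ν x : ℂ) / ((lev L k : ℕ) : ℂ)) + Complex.exp (-(Complex.I * (A₀ k ν x : ℂ) / ((lev L k : ℕ) : ℂ)))))
      = fun k x => ∑ ν, (-(Complex.I * (A k ν x : ℂ)) * (Complex.I * (B k ν x : ℂ)))
        * (Complex.exp (Complex.I * (A₀ k ν x : ℂ) / ((lev L k : ℕ) : ℂ)) + Complex.exp (-(Complex.I * (A₀ k ν x : ℂ) / ((lev L k : ℕ) : ℂ)))) := by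
    funext k x
    rw [← Finset.sum_neg_distrib]
    refine Finset.sum_congr rfl fun ν _ => ?_
    ring
  rw [e]
  exact h

end Letters

end Summit.QuantumFields.BalabanUV.Beta.GAN24.ExponentialChartBaseBackgrounds

end
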